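import Mathlib.RingTheory.SimpleModule.Rank
import Literature.NumberTheory.Automorphic.RankinSelbergLocal
import Literature.NumberTheory.Automorphic.AdelicAdditiveCharacterDuality
import Literature.NumberTheory.Automorphic.AdicCompletionLocalField
import HarnessLib

/-!
# The named fact `existsUnique_hasRSGamma` of `RankinSelbergLocal` is false as elaborated

`Literature/NumberTheory/Automorphic/RankinSelbergLocal.lean` records Jacquet–Piatetski-Shapiro–
Shalika's local functional equation (1983, Thm. 2.7 (iii); Cogdell 2004, Thm. 6.2) as the named
fact `existsUnique_hasRSGamma hmn π π' ψ ν μ : Prop` (`∃! γ ∈ ℂ(q^{-s})` with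
`Ψ̃(1 - s; ρ(w_{n,m}) W̃, W̃') = ω_{π'}(-1)^{n-1} γ Ψ(s; W, W')`). Its docstring and the module's
design notes require `ν` to be THE invariant measure on `GL_m(F) ⧸ U_m` and `μ` an additive
Haar measure on `F`, and the file declares `[BorelSpace (GL_m ⧸ U_m)]`,
`[SMulInvariantMeasure GL_m (GL_m ⧸ U_m) ν]`, `[IsFiniteMeasureOnCompacts ν]`, `[ν.IsOpenPosMeasure]`,
`[BorelSpace F]`, `[μ.IsAddHaarMeasure]` as section instances — but a `def … : Prop` captures
only the section variables its body mentions, so NONE of these hypotheses is an argument of the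
fact (`@existsUnique_hasRSGamma` ends `… (ν : Measure (GL (Fin m) F ⧸ _)) [MeasurableSpace F]
(μ : Measure F) : Prop`; the same holds for `existsUnique_hasRSLFactor`,
`hasRSLFactor_of_isSatakeParameter`, `existsUnique_hasRSEpsilon`, see
`RankinSelbergLocalUniqueness`). As elaborated, the fact therefore quantifies over ARBITRARY
measures and is false:

* `hasRSGamma_zero_measure`: for `ν = 0` every zeta integral `∫ … ∂0` vanishes, so
  `HasRSGamma hmn π π' ψ μ 0 γ` holds for EVERY `γ` as soon as `π'` has a central character
  (`R = R̃ = 0`); hence `¬ ∃! γ` (`not_existsUnique_hasRSGamma_zero_measure`), and the fact fails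
  at `ν = 0` whenever its hypotheses on `π, π', ψ` are met
  (`not_existsUnique_hasRSGamma_zero_measure_of_hyp`).
* `not_forall_existsUnique_hasRSGamma`: a CLOSED counterexample to the universally quantified
  fact — `F = ℚ_v` (the completion of `ℚ` at a finite place, a non-archimedean local field by
  `AdicCompletionLocalField`), `ψ = ψ_v` the local component of Tate's character (non-trivial at
  all but finitely many `v`, `eventually_exists_adeleAddCharAt_ne_one` of
  `AdelicAdditiveCharacterDuality`; there are infinitely many `v`), `n = 1`, `m = 0`, `π`, `π'` the
  trivial representations of `GL_1(ℚ_v)`, `GL_0(ℚ_v)` on `ℂ` (irreducible, admissible, and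
  generic since `U_1`, `U_0` are trivial), `ν = 0`, `μ = 0`.

So `theorem existsUnique_hasRSGamma_holds : existsUnique_hasRSGamma …` (universally closed) is
REFUTED; the intended statement — and, by JPSS Thm. 2.7 (iii), the true one — carries the six
instance hypotheses inside the `∀`. It is proposed under a new name (`JPSS1983_existsUnique_hasRSGamma`,
sibling file `RankinSelbergLocalFunctionalEquation`, review-queued); the uniqueness theorems of
`RankinSelbergLocalUniqueness` hold for every `ν`, `μ` and serve it unchanged.

## References

* H. Jacquet, I. I. Piatetski-Shapiro, J. Shalika, *Rankin–Selberg convolutions*, Amer. J. Math.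
  105 (1983), 367–464, Thm. 2.7 (iii). [JacquetPiatetskiShapiroShalika1983]
* J. W. Cogdell, *Lectures on `L`-functions, converse theorems, and functoriality for `GL_n`*,
  Fields Inst. Monogr. 20 (2004), Lecture 6, Thm. 6.2 (read: the integrals are over
  `N_m(k)\GL_m(k)` with its invariant measure, `dx` Haar on `M_{j×m}(k)`). [Cogdell2004]
-/

set_option autoImplicit false

open MeasureTheory NumberField IsDedekindDomain

noncomputable section

namespace Literature.NumberTheory.Automorphic

/-! ### The fact at the zero measure on `GL_m ⧸ U_m` -/

section ZeroMeasure

variable {F : Type*} [Field F] [ValuativeRel F] [TopologicalSpace F] [IsNonarchimedeanLocalField F]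
  {n m : ℕ} {V : Type*} [AddCommGroup V] [Module ℂ V] {V' : Type*} [AddCommGroup V'] [Module ℂ V']
  [MeasurableSpace (GL (Fin m) F ⧸ upperUnitriangular (Fin m) F)]
  {hmn : m < n} {π : Representation ℂ (GL (Fin n) F) V} {π' : Representation ℂ (GL (Fin m) F) V'}
  {ψ : AddChar F Circle} [MeasurableSpace F] {μ : Measure F}

omit [MeasurableSpace F] in
/-- Against the zero measure on `GL_m ⧸ U_m` every zeta integral `Ψ(s; W, W') = ∫ … ∂0`
vanishes. [folklore] -/
theorem rsZeta_zero_measure (W : GL (Fin n) F → ℂ) (W' : GL (Fin m) F → ℂ) (s : ℂ) :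
    rsZeta hmn (0 : Measure (GL (Fin m) F ⧸ upperUnitriangular (Fin m) F)) W W' s = 0 := by
  simp [rsZeta]

/-- Against the zero measure on `GL_m ⧸ U_m` every modified zeta integral `Ψ_{n-m-1}` vanishes.
[folklore] -/
theorem rsZetaTilde_zero_measure (W : GL (Fin n) F → ℂ) (W' : GL (Fin m) F → ℂ) (s : ℂ) :
    rsZetaTilde hmn μ (0 : Measure (GL (Fin m) F ⧸ upperUnitriangular (Fin m) F)) W W' s = 0 := by
  simp [rsZetaTilde, rsZeta]

/-- **For `ν = 0` every `γ` is a "`γ`-factor".** If `π'` has a central character `ω`, then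
`HasRSGamma hmn π π' ψ μ 0 γ` holds for every `γ ∈ ℂ(T)`: both sides of the functional equation
vanish identically, so `R = R̃ = 0` interpolate them and `0 = ω(-1)^{n-1} γ · 0`. [folklore] -/
theorem hasRSGamma_zero_measure {ω : Subgroup.center (GL (Fin m) F) →* ℂˣ}
    (hω : π'.HasCentralCharacter ω) (γ : RatFunc ℂ) :
    HasRSGamma hmn π π' ψ μ (0 : Measure (GL (Fin m) F ⧸ upperUnitriangular (Fin m) F)) γ :=
  ⟨ω, hω, fun _ _ _ _ _ _ =>
    ⟨0, 0, ⟨0, fun s _ => by simp [rsZeta, evalAtQ]⟩,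
      ⟨0, fun s _ => by simp [rsZetaTilde, rsZeta, evalAtQ]⟩, by simp⟩⟩

/-- Hence **for `ν = 0` the `γ`-factor is not unique** (`0` and `1` both qualify) as soon as
`π'` has a central character. [folklore] -/
theorem not_existsUnique_hasRSGamma_zero_measure
    (hω : ∃ ω : Subgroup.center (GL (Fin m) F) →* ℂˣ, π'.HasCentralCharacter ω) :
    ¬ ∃! γ : RatFunc ℂ,
      HasRSGamma hmn π π' ψ μ (0 : Measure (GL (Fin m) F ⧸ upperUnitriangular (Fin m) F)) γ := by
  rintro ⟨γ, -, hγ⟩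
  obtain ⟨ω, hω⟩ := hω
  have h0 := hγ 0 (hasRSGamma_zero_measure hω 0)
  have h1 := hγ 1 (hasRSGamma_zero_measure hω 1)
  exact zero_ne_one (h0.trans h1.symm)

/-- **The named fact `existsUnique_hasRSGamma` fails at `ν = 0`** for all data meeting its
hypotheses (`π`, `π'` irreducible admissible generic, `ψ` non-trivial continuous) with `π'`
having a central character (automatic for irreducible admissible `π'` by Schur's lemma,
`Representation.exists_hasCentralCharacter_holds`; kept as an explicit hypothesis here to avoid
topological-group instances on `GL_m(F)`). The measure `ν = 0` is admitted by the fact because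
its invariance/positivity hypotheses were section instances not captured by the `def`.
[folklore] -/
theorem not_existsUnique_hasRSGamma_zero_measure_of_hyp [π.IsIrreducible] [π'.IsIrreducible]
    (hπ : π.IsAdmissible) (hπ' : π'.IsAdmissible) (hg : IsGeneric π ψ) (hg' : IsGeneric π' ψ⁻¹)
    (hψ : ψ.IsContinuousNontrivial)
    (hω : ∃ ω : Subgroup.center (GL (Fin m) F) →* ℂˣ, π'.HasCentralCharacter ω) :
    ¬ existsUnique_hasRSGamma hmn π π' ψ
        (0 : Measure (GL (Fin m) F ⧸ upperUnitriangular (Fin m) F)) μ :=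
  fun h => not_existsUnique_hasRSGamma_zero_measure hω (h hπ hπ' hg hg' hψ)

end ZeroMeasure

/-! ### Trivial representations of `GL_n`, `n ≤ 1`, meet the hypotheses of the fact -/

section TrivialData

/-- One-dimensional representations are irreducible: the only subspaces of the line are `⊥`
and `⊤`. (Local copy, for the trivial representation on `ℂ`, of the folklore lemma
`isIrreducible_of_finrank_eq_one'` of `GKModulesAdmissible`, to keep the imports of this
counterexample file light.) [folklore] -/
theorem isIrreducible_trivial_complex (G : Type*) [Monoid G] :
    (Representation.trivial ℂ G ℂ).IsIrreducible := by
  have hs : IsSimpleModule ℂ ℂ := isSimpleModule_iff_finrank_eq_one.2 (Module.finrank_self ℂ)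
  have hinj := Subrepresentation.toSubmodule_injective (ρ := Representation.trivial ℂ G ℂ)
  have hbot : (⊥ : Subrepresentation (Representation.trivial ℂ G ℂ)).toSubmodule = ⊥ := rfl
  have htop : (⊤ : Subrepresentation (Representation.trivial ℂ G ℂ)).toSubmodule = ⊤ := rfl
  haveI : Nontrivial (Subrepresentation (Representation.trivial ℂ G ℂ)) := ⟨⟨⊥, ⊤, fun e => by
    have := congrArg Subrepresentation.toSubmodule e
    rw [hbot, htop] at this
    exact bot_ne_top this⟩⟩
  refine ⟨fun U => ?_⟩
  rcases eq_bot_or_eq_top U.toSubmodule with hU | hU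
  · exact Or.inl (hinj (hU.trans hbot.symm))
  · exact Or.inr (hinj (hU.trans htop.symm))

/-- The trivial representation of a topological group on `ℂ` is admissible: it is smooth
(all stabilisers are `G`, cf. `Representation.isSmooth_trivial`) and every space of fixed
vectors is a subspace of the line. [folklore] -/
theorem isAdmissible_trivial_complex (G : Type*) [Group G] [TopologicalSpace G] :
    (Representation.trivial ℂ G ℂ).IsAdmissible := by
  refine ⟨fun v => ?_, fun K _ => inferInstance⟩
  have h : ((Representation.trivial ℂ G ℂ).stabilizerSubgroup v : Set G) = Set.univ := by
    ext g
    simp [Representation.mem_stabilizerSubgroup]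
  rw [Representation.IsSmoothVector, h]
  exact isOpen_univ

/-- The trivial representation has the trivial central character. [folklore] -/
theorem hasCentralCharacter_one_trivial (G V : Type*) [Group G] [AddCommGroup V] [Module ℂ V] :
    (Representation.trivial ℂ G V).HasCentralCharacter 1 := fun z => by
  ext v
  simp

/-- For `n ≤ 1` the group `U_n` has no super-diagonal: `∑ u_{i,i+1} = 0`. [folklore] -/
theorem superdiagSum_eq_zero_of_le_one {R : Type*} [CommRing R] {n : ℕ} (hn : n ≤ 1)
    (u : ↥(upperUnitriangular (Fin n) R)) : superdiagSum u = 0 := by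
  rw [superdiagSum_def]
  refine Finset.sum_eq_zero fun i _ => Finset.sum_eq_zero fun j _ => ?_
  have hi := i.isLt
  have hj := j.isLt
  rw [if_neg (by omega)]

/-- For `n ≤ 1` the generic character of `U_n` is trivial. [folklore] -/
theorem whittakerCharFun_eq_one_of_le_one {R : Type*} [CommRing R] {n : ℕ} (ψ : AddChar R Circle)
    (hn : n ≤ 1) (u : ↥(upperUnitriangular (Fin n) R)) : whittakerCharFun ψ u = 1 := by
  rw [whittakerCharFun_apply, superdiagSum_eq_zero_of_le_one hn, AddChar.map_zero_eq_one,
    Circle.coe_one]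

/-- For `n ≤ 1` the trivial representation of `GL_n` on `ℂ` is generic with respect to every
`ψ`: the identity of `ℂ` is a non-zero Whittaker functional (`U_n` acts trivially and `ψ_U = 1`).
(For `n ≤ 1` every linear form is a Whittaker functional, cf. the design notes of
`WhittakerModels`.) [folklore] -/
theorem isGeneric_trivial_of_le_one {R : Type*} [CommRing R] {n : ℕ} (hn : n ≤ 1)
    (ψ : AddChar R Circle) : IsGeneric (Representation.trivial ℂ (GL (Fin n) R) ℂ) ψ := by
  rw [isGeneric_iff]
  refine ⟨LinearMap.id, fun u v => ?_, fun h => ?_⟩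
  · rw [whittakerCharFun_eq_one_of_le_one ψ hn, one_mul, Representation.trivial_apply]
  · exact one_ne_zero (LinearMap.congr_fun h (1 : ℂ))

end TrivialData

/-! ### A closed counterexample over `ℚ_v` -/

section Counterexample

/-- A number field has infinitely many finite places (above every rational prime lies a prime
of `𝓞 K`, and primes above distinct rational primes are distinct; Neukirch, *Algebraic number
theory*, Ch. I §8). Local copy of `infinite_heightOneSpectrum` of `JacquetLanglandsParts`, to
keep the imports of this counterexample file light. [folklore] -/
theorem infinite_heightOneSpectrum' (K : Type) [Field K] [NumberField K] :
    Infinite (HeightOneSpectrum (𝓞 K)) := by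
  classical
  have hinj : Function.Injective (algebraMap ℤ (𝓞 K)) := (algebraMap ℤ (𝓞 K)).injective_int
  have key : ∀ p : Nat.Primes, ∃ w : HeightOneSpectrum (𝓞 K),
      w.asIdeal.comap (algebraMap ℤ (𝓞 K)) = Ideal.span {(p : ℤ)} := by
    intro p
    have hp : Prime (p : ℤ) := Nat.prime_iff_prime_int.mp p.2
    haveI : (Ideal.span {(p : ℤ)}).IsPrime := (Ideal.span_singleton_prime hp.ne_zero).mpr hp
    obtain ⟨Q, -, hQ, hQp⟩ := Ideal.exists_ideal_over_prime_of_isIntegral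
      (S := 𝓞 K) (Ideal.span {(p : ℤ)}) ⊥
      (by
        rw [← RingHom.ker_eq_comap_bot, (RingHom.injective_iff_ker_eq_bot _).mp hinj]
        exact bot_le)
    refine ⟨⟨Q, hQ, fun hQbot => hp.ne_zero ?_⟩, hQp⟩
    have hmem : (p : ℤ) ∈ Q.comap (algebraMap ℤ (𝓞 K)) := by
      rw [hQp]
      exact Ideal.mem_span_singleton_self _
    rw [hQbot, Ideal.mem_comap, Ideal.mem_bot, map_eq_zero_iff _ hinj] at hmem
    exact hmem
  choose f hf using key
  refine Infinite.of_injective f fun p q hpq => ?_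
  have h := hf p
  rw [hpq, hf q, Ideal.span_singleton_eq_span_singleton, Int.associated_iff_natAbs,
    Int.natAbs_natCast, Int.natAbs_natCast] at h
  exact Subtype.ext h.symm

/-- **The named fact `existsUnique_hasRSGamma` of `RankinSelbergLocal`, universally closed, is
FALSE.** Counterexample: `F = ℚ_v` for a finite place `v` of `ℚ` at which the local component
`ψ_v` of Tate's character is non-trivial (all but finitely many `v`,
`eventually_exists_adeleAddCharAt_ne_one`; `ψ_v` is continuous, `continuous_adeleAddCharAt`),
`n = 1`, `m = 0`, `π`, `π'` the trivial representations of `GL_1(ℚ_v)`, `GL_0(ℚ_v)` on `ℂ`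
(irreducible, admissible, generic: `U_1 = U_0 = 1`), and the ZERO measures `ν = 0` on
`GL_0 ⧸ U_0`, `μ = 0` on `F`, which the fact admits because its invariance / Haar hypotheses were
section instances not captured by the `def`: then every `γ` satisfies `HasRSGamma`
(`hasRSGamma_zero_measure`), contradicting `∃!`. The intended statement (JPSS 1983,
Thm. 2.7 (iii), with `ν` invariant Radon and `μ` additive Haar) is proposed separately as
`JPSS1983_existsUnique_hasRSGamma` (sibling file `RankinSelbergLocalFunctionalEquation`). [folklore] -/
theorem not_forall_existsUnique_hasRSGamma :
    ¬ ∀ (F : Type) [Field F] [ValuativeRel F] [TopologicalSpace F] [IsNonarchimedeanLocalField F]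
        (n m : ℕ) (V : Type) [AddCommGroup V] [Module ℂ V] (V' : Type) [AddCommGroup V']
        [Module ℂ V'] (hmn : m < n) (π : Representation ℂ (GL (Fin n) F) V)
        (π' : Representation ℂ (GL (Fin m) F) V') (ψ : AddChar F Circle)
        [MeasurableSpace (GL (Fin m) F ⧸ upperUnitriangular (Fin m) F)]
        (ν : Measure (GL (Fin m) F ⧸ upperUnitriangular (Fin m) F)) [MeasurableSpace F]
        (μ : Measure F), existsUnique_hasRSGamma hmn π π' ψ ν μ := by
  intro h
  haveI := infinite_heightOneSpectrum' ℚ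
  obtain ⟨v, u, -, hu⟩ := (eventually_exists_adeleAddCharAt_ne_one ℚ).exists
  letI : MeasurableSpace (v.adicCompletion ℚ) := ⊤
  letI : MeasurableSpace (GL (Fin 0) (v.adicCompletion ℚ) ⧸
      upperUnitriangular (Fin 0) (v.adicCompletion ℚ)) := ⊤
  haveI := isIrreducible_trivial_complex (GL (Fin 1) (v.adicCompletion ℚ))
  haveI := isIrreducible_trivial_complex (GL (Fin 0) (v.adicCompletion ℚ))
  have hψ : (adeleAddCharAt ℚ v).IsContinuousNontrivial :=
    ⟨continuous_adeleAddCharAt ℚ v, fun h0 => hu (by rw [h0, AddChar.zero_apply])⟩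
  exact not_existsUnique_hasRSGamma_zero_measure_of_hyp (μ := 0)
    (isAdmissible_trivial_complex _) (isAdmissible_trivial_complex _)
    (isGeneric_trivial_of_le_one le_rfl _) (isGeneric_trivial_of_le_one (Nat.zero_le 1) _) hψ
    ⟨1, hasCentralCharacter_one_trivial _ _⟩
    (h (v.adicCompletion ℚ) 1 0 ℂ ℂ Nat.zero_lt_one (Representation.trivial ℂ _ ℂ)
      (Representation.trivial ℂ _ ℂ) (adeleAddCharAt ℚ v) 0 0)

end Counterexample

end Literature.NumberTheory.Automorphic
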